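import Literature.NumberTheory.EllipticCurves.OrdinaryReductionTorsionLineProofs
import Literature.NumberTheory.EllipticCurves.HasseWeilGoodReductionFrobeniusProofs
import HarnessLib

/-!
# The ordinary counts at the good local model of an elliptic curve at `v ∣ p` (Greenberg LNM 1716 p. 62; Silverman V.3.1)

Cell `bsd-print-cf2`, seat `bsd-line-cf2-p1-w2` g5; ROUTE-FREE helper toward crux stmt-BirchSwinnertonDyer-20368 (brick F-A of the discharge
road of `stub_finLoc_two`, `Cruxes/SplitBadTwoRankOneOfFacts/TURNKEY-20368-finLoc-w2g5.md`). THEOREMS ONLY; closes nothing by itself; BSD is not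
advanced by any of this. Part II of `OrdinaryReductionTateModuleProofs` (Steps 2–3) exposed as a reusable statement: for `W/K` with good ORDINARY
reduction at `v ∣ p` and the `𝒪_w`-model `(W.localMinimalIntegralModel v).map φ` with unit discriminant, the kernel of the reduction homomorphism has
exactly `p^r` points killed by `p^r` and the reduction is onto the `p^r`-torsion of the reduced curve (`natCard_torsionBy_ker_goodReductionHom_eq`
fed with the ordinary point of `exists_zsmul_eq_zero_goodReductionHom_ne_zero`). Consumer: `OrdinaryReductionFrobeniusEigenvalue`.
-/

noncomputable section

open scoped Classical NNReal NumberField AddSubgroup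
open NumberField IsDedekindDomain Polynomial

namespace Summit.BirchSwinnertonDyer.BirchSwinnertonDyer.Theorems.OrdinaryFrobenius

open _root_.WeierstrassCurve Literature.NumberTheory.EllipticCurves Literature.NumberTheory.GaloisRepresentations Field
  IsDedekindDomain.HeightOneSpectrum

set_option linter.dupNamespace false
set_option autoImplicit false

/-- **The ordinary counts at the good local model** (Part II of `OrdinaryReductionTateModuleProofs`, Steps 2–3, exposed): at a place
`v ∣ p` of good ordinary reduction, for the `𝒪_w`-model `MO = M.map φ` of the local minimal model (unit discriminant), the kernel of the
reduction homomorphism has exactly `p^r` points killed by `p^r` and the reduction is onto the `p^r`-torsion of the reduced curve, for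
every `r` (Greenberg LNM 1716 p. 62; Silverman V.3.1, VII.2.1). [cite: GreenbergLNM1716, §2 p. 62] [cite: SilvermanAEC2009, Thm. V.3.1, Prop. VII.2.1] -/
theorem goodReduction_ordinary_counts {K : Type} [Field K] [NumberField K]
    (W : WeierstrassCurve K) [W.IsElliptic] (p : ℕ) [hp : Fact p.Prime]
    (v : HeightOneSpectrum (𝓞 K)) (hpv : (p : 𝓞 K) ∈ v.asIdeal) (hgood : W.HasGoodReductionAt v)
    (hord : ¬ ((p : ℤ) ∣ W.frobeniusTraceAt v))
    {w : Valuation (AlgebraicClosure (v.adicCompletion K)) ℝ≥0}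
    (hw : ∀ x, (w x : ℝ) = spectralNorm (v.adicCompletion K) (AlgebraicClosure (v.adicCompletion K)) x)
    {φO : v.adicCompletionIntegers K →+* w.valuationSubring}
    (hΔO : IsUnit ((W.localMinimalIntegralModel v).map φO).Δ) (r : ℕ) :
    Nat.card (AddSubgroup.torsionBy (goodReductionHom ((W.localMinimalIntegralModel v).map φO)
        (Valuation.valuationSubring.integers w) hΔO).ker ((p : ℤ) ^ r)) = p ^ r ∧
      ∀ Q : (((W.localMinimalIntegralModel v).map φO).map (IsLocalRing.residue w.valuationSubring)).toAffine.Point,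
        ((p ^ r : ℕ) : ℤ) • Q = 0 →
        ∃ P : (((W.localMinimalIntegralModel v).map φO).baseChange (AlgebraicClosure (v.adicCompletion K))).toAffine.Point,
          ((p ^ r : ℕ) : ℤ) • P = 0 ∧
            goodReductionHom ((W.localMinimalIntegralModel v).map φO) (Valuation.valuationSubring.integers w) hΔO P = Q := by
  haveI : CharZero (v.adicCompletion K) :=
    charZero_of_injective_algebraMap (algebraMap K (v.adicCompletion K)).injective
  haveI : CharZero (AlgebraicClosure (v.adicCompletion K)) :=
    charZero_of_injective_algebraMap
      (algebraMap (v.adicCompletion K) (AlgebraicClosure (v.adicCompletion K))).injective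
  have hvO : w.Integers w.valuationSubring := Valuation.valuationSubring.integers w
  haveI := isElliptic_reductionAt hgood
  have hEv' : W.reductionAt v = (W.localMinimalIntegralModel v).map
      (IsLocalRing.residue (v.adicCompletionIntegers K)) := WeierstrassCurve.reductionAt_eq_map_residue W v
  -- residue characteristic `p` downstairs
  have hpO : w ((p : ℕ) : AlgebraicClosure (v.adicCompletion K)) < 1 := by
    have h := spectralValuation_algebraMap_ringOfIntegers_lt_one (v := v) hw hpv
    rw [map_natCast] at h
    exact h
  haveI hchar : CharP (IsLocalRing.ResidueField w.valuationSubring) p := by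
    refine (CharP.charP_iff_prime_eq_zero hp.out).mpr ?_
    have e1 : IsLocalRing.residue w.valuationSubring (p : w.valuationSubring) = p := map_natCast _ p
    rw [← e1, IsLocalRing.residue_eq_zero_iff, IsLocalRing.mem_maximalIdeal, mem_nonunits_iff,
      hvO.isUnit_iff_valuation_eq_one]
    exact fun h ↦ absurd h (ne_of_lt (by simpa using hpO))
  haveI hcharv : CharP (IsLocalRing.ResidueField (v.adicCompletionIntegers K)) p := by
    refine (CharP.charP_iff_prime_eq_zero hp.out).mpr ?_
    have h := (residue_algebraMap_eq_zero_iff K v (p : 𝓞 K)).mpr hpv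
    rw [map_natCast, map_natCast] at h
    exact h
  -- some `p`-torsion point has non-zero reduction (ordinary)
  have hdegE : ((W.reductionAt v).ΨSq p).natDegree ≠ 0 :=
    natDegree_ΨSq_ne_zero_of_not_dvd_trace (W.reductionAt v) p (by rw [frobeniusTraceAt_def] at hord; exact hord)
  have hdegMO : ((((W.localMinimalIntegralModel v).map φO).ΨSq p).map
      (IsLocalRing.residue w.valuationSubring)).natDegree ≠ 0 := by
    rw [WeierstrassCurve.map_ΨSq]
    refine natDegree_map_map_residue_ne_zero φO _ ?_
    rw [hEv', WeierstrassCurve.map_ΨSq] at hdegE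
    exact hdegE
  have hordMO := exists_zsmul_eq_zero_goodReductionHom_ne_zero w.valuationSubring hvO hΔO p hdegMO
  exact natCard_torsionBy_ker_goodReductionHom_eq w.valuationSubring hvO hΔO hordMO r



end Summit.BirchSwinnertonDyer.BirchSwinnertonDyer.Theorems.OrdinaryFrobenius

end
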